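import Summits.BirchSwinnertonDyer.BirchSwinnertonDyer.Theorems.Rank1ResidualX11RankOneMinimality
import HarnessLib

/-!
# BSD rank-≤1 residual cell, class X11b, Cha-certificate pairs: a third Kraus pattern at `2`
# (`c₆ = 2¹⁰·odd`, `ord₂ Δ < 24`) and the global-minimality criterion it completes

HONEST FRAMING (cell `b2b-bsdres-*`, verbatim): prove what is provable now; shrink each hard class
to its core with data; no claim beyond stated classes; COMBINATION classes deleted from PUBLISHED
theorems only, CONSTRUCTION-shaped remainder typed; this is not "finishing BSD". Nothing here is
specific to BSD. Theorems only (no definition, no named fact).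

Unit `b2b-bsdres-x11c` (gen 3) certifies `BSD(E,5)` per pair for the 24 RESISTANT pairs of
X11 ∧ r = 1 ∧ ¬sst ∧ p ≥ 5 with `5 ∤ ∏ c_q` by Cha's Heegner-index bound (`X11b/ChaRoute.lean`,
`X11b/ChaPairs*.lean`). As for the 85 window records (`Rank1ResidualX11RankOneMinimality.lean`),
global minimality of Cremona's model is decided in the kernel by Silverman's criterion
(`ord_q Δ < 12 ∨ ord_q c₄ < 4`, *AEC* VII.1 Rem. 1.1) or a Kraus pattern at `q = 2, 3`. Two of the
24 models (`25920a1 = [0,0,0,−34128,2425248]`, `92480b1 = [0,0,0,−1088,−12512]`: `ord₂ Δ = 14`,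
`ord₂ c₄ ≥ 8`, `ord₂ c₆ = 10`) fit none of the three patterns already in the tree (F2a:
`4 ≤ ord₂ c₄ < 8 ∧ ord₂ c₆ ≥ 7`; F2b: `c₆ = 2⁹L, L ≡ 3 (4)`; F3); this file adds

* `isMinimalAt_two_of_c₆_eq_1024_mul` (pattern **F2c**): `W/ℚ` integral at the place of `2`,
  `ord₂ Δ < 24`, `c₆ = 1024·M` with `M` odd ⟹ minimal at `2`. For the only possible descent
  `u = 2w` (`w` a unit) the descended `c₆' = c₆/(64w⁶) = 16y`, `y = M w⁻⁶` a unit: `|c₆'| = 2⁻⁴`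
  and `|c₆' − 8| = 2⁻³` exceed `2⁻⁵`, and `c₆' + 1` is a unit — every alternative of Kraus's
  condition at `2` (`16 ∣ c₄' ∧ c₆' ≡ 0, 8 (32)`, or `c₆' ≡ −1 (4)`; tree theorem
  `isMinimal_of_kraus_fails_of_Δ`, Kraus 1989 Prop. 2) fails;
* `isGloballyMinimal_of_krausCriterion₂` / `…_bounded₂`: the criterion of
  `X11RankOne.isGloballyMinimal_of_krausCriterion[_bounded]` with F2c as a further disjunct (the
  bounded form is what `decide` evaluates per model).

References: A. Kraus, Acta Arith. 54 (1989) 75–80, Prop. 2 [Kraus1989]; J. E. Cremona, *Algorithms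
for Modular Elliptic Curves* (1997) §3.2 [CremonaAlgorithms1997]; J. H. Silverman, *AEC* (2009)
VII.1 Rem. 1.1, VIII.8 [SilvermanAEC2009].
-/

set_option linter.dupNamespace false
set_option autoImplicit false

noncomputable section

open scoped Classical

open IsDedekindDomain NumberField Rat.HeightOneSpectrum WeierstrassCurve
  Literature.NumberTheory.EllipticCurves Literature.NumberTheory.GaloisRepresentations
  Literature.NumberTheory.EllipticCurves.Rank1Residual.X11RankOneCertificates
  Summit.BirchSwinnertonDyer.BirchSwinnertonDyer.Rank1Residual.X11RankOne

namespace Summit.BirchSwinnertonDyer.Rank1Residual.X11b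

/-! ### §1. Pattern F2c at the place of `2` -/

section Two

variable (v : HeightOneSpectrum (𝓞 ℚ)) (W : WeierstrassCurve ℚ)

/-- **Minimality at `2`, pattern `c₆ = 2¹⁰M`, `M` odd, `ord₂ Δ < 24` (F2c).** For `W / ℚ` integral at
the place `v` of `2` with `|Δ|₂ > 2⁻²⁴` and `c₆(W) = 1024·M`, `2 ∤ M`: `W` is minimal at `v`. For the
only possible descent `u = 2w` the descended `c₆' = c₆/(64w⁶) = 16y` with `y = M w⁻⁶` a unit:
`|c₆'| = 2⁻⁴ > 2⁻⁵`, `|c₆' − 8| = |8|·|2y − 1| = 2⁻³ > 2⁻⁵`, and `c₆' + 1` is a unit, so all of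
Kraus's alternatives fail (`isMinimal_of_kraus_fails_of_Δ`). Covers Cremona's models `25920a1`,
`92480b1` (and `25920cm1`, `92480ch1`). [cite: Kraus1989, Prop. 2]
[cite: CremonaAlgorithms1997, §3.2 (Laska–Kraus–Connell)] -/
theorem isMinimalAt_two_of_c₆_eq_1024_mul (hv : natGenerator v = 2) (hint : W.IsIntegralAt v)
    (hΔ : WithZero.exp (-24 : ℤ) < v.valuation ℚ W.Δ) {M : ℤ} (hM : W.c₆ = 1024 * M)
    (hModd : ¬ (2 : ℤ) ∣ M) : W.IsMinimalAt v := by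
  set K := v.adicCompletion ℚ with hK
  set Y : WeierstrassCurve K := W.baseChange K with hY
  haveI : Y.IsIntegral (v.adicCompletionIntegers ℚ) := hint
  have V2 := valued_two v hv
  have h20 : (2 : K) ≠ 0 := by
    intro h; rw [h, Valuation.map_zero] at V2; exact WithZero.coe_ne_zero V2.symm
  have V8 : Valued.v (8 : K) = WithZero.exp (-3 : ℤ) := by
    rw [show (8 : K) = 2 ^ 3 by norm_num, Valuation.map_pow, V2, ← WithZero.exp_nsmul]; norm_num
  have V16 : Valued.v (16 : K) = WithZero.exp (-4 : ℤ) := by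
    rw [show (16 : K) = 2 ^ 4 by norm_num, Valuation.map_pow, V2, ← WithZero.exp_nsmul]; norm_num
  have hYΔ : WithZero.exp (-24 : ℤ) < Valued.v Y.Δ := by
    rw [hY, WeierstrassCurve.baseChange, map_Δ, WeierstrassCurve.valued_algebraMap_adicCompletion]; exact hΔ
  have hYc6 : Y.c₆ = 1024 * algebraMap ℚ K M := by
    rw [hY, WeierstrassCurve.baseChange, map_c₆, hM, map_mul]; norm_num
  set l : K := algebraMap ℚ K M with hl
  have hVl : Valued.v l = 1 := valued_intCast_eq_one_of_odd v hv hModd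
  refine isMinimal_of_kraus_fails_of_Δ v hv Y hYΔ fun w hw H ↦ ?_
  have hw0 : w ≠ 0 := by
    intro h; rw [h, Valuation.map_zero] at hw; exact zero_ne_one hw
  have hwi : Valued.v w⁻¹ = 1 := by rw [map_inv₀, hw, inv_one]
  set y : K := w⁻¹ ^ 6 * l with hy
  have hunit : Valued.v y = 1 := by
    rw [hy, Valuation.map_mul, Valuation.map_pow, hwi, one_pow, one_mul, hVl]
  have h64 : (64 : K) ≠ 0 := by
    rw [show (64 : K) = 2 ^ 6 by norm_num]; exact pow_ne_zero _ h20
  have he : Y.c₆ / (64 * w ^ 6) = 16 * y := by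
    rw [hYc6, hy, div_eq_iff (mul_ne_zero h64 (pow_ne_zero 6 hw0)), inv_pow,
      show (16 : K) * ((w ^ 6)⁻¹ * l) * (64 * w ^ 6) = 1024 * l * ((w ^ 6)⁻¹ * w ^ 6) by ring,
      inv_mul_cancel₀ (pow_ne_zero 6 hw0), mul_one]
  rw [he] at H
  rcases H with ⟨-, h | h⟩ | h
  · -- `|16 y| = 2⁻⁴ > 2⁻⁵`
    rw [Valuation.map_mul, V16, hunit, mul_one, WithZero.exp_le_exp] at h
    norm_num at h
  · -- `16y - 8 = 8(2y - 1)` and `2y - 1` is a unit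
    have hlt : Valued.v (2 * y) < Valued.v (1 : K) := by
      rw [Valuation.map_one, Valuation.map_mul, V2, hunit, mul_one, ← WithZero.exp_zero,
        WithZero.exp_lt_exp]
      norm_num
    have h21 : Valued.v (2 * y - 1) = 1 := by
      rw [sub_eq_add_neg, Valuation.map_add_eq_of_lt_right _ (by rwa [Valuation.map_neg]),
        Valuation.map_neg, Valuation.map_one]
    have : (16 : K) * y - 8 = 8 * (2 * y - 1) := by ring
    rw [this, Valuation.map_mul, V8, h21, mul_one, WithZero.exp_le_exp] at h
    norm_num at h
  · have hlt3 : Valued.v (16 * y) < Valued.v (1 : K) := by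
      rw [Valuation.map_one, Valuation.map_mul, V16, hunit, mul_one, ← WithZero.exp_zero,
        WithZero.exp_lt_exp]
      norm_num
    have : Valued.v (16 * y + 1) = 1 := by
      rw [Valuation.map_add_eq_of_lt_right _ hlt3, Valuation.map_one]
    rw [this, ← WithZero.exp_zero, WithZero.exp_le_exp] at h
    norm_num at h

end Two

/-! ### §2. The global criterion with pattern F2c -/

/-- **An integer Weierstrass model is globally minimal when every prime `q` satisfies Silverman's
criterion (`q¹² ∤ Δ` or `q⁴ ∤ c₄`) or one of the Kraus patterns F2a (`2⁸ ∤ c₄ ∧ 2⁷ ∣ c₆`), F2c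
(`2²⁴ ∤ Δ ∧ c₆ = 2¹⁰M, M odd`), F3 (`3⁸ ‖ c₆`).** `Δ`, `c₄`, `c₆` are the tree-rechecked integers
`discOf`/`c4Of`/`c6Of`. [cite: SilvermanAEC2009, VII.1 Remark 1.1 and VIII.8] [cite: Kraus1989, Prop. 1 and Prop. 2] -/
theorem isGloballyMinimal_of_krausCriterion₂ (a1 a2 a3 a4 a6 : ℤ)
    (h : ∀ q : ℕ, q.Prime →
      (¬ (q : ℤ) ^ 12 ∣ discOf [a1, a2, a3, a4, a6] ∨ ¬ (q : ℤ) ^ 4 ∣ c4Of [a1, a2, a3, a4, a6]) ∨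
      (q = 2 ∧ ¬ (2 : ℤ) ^ 8 ∣ c4Of [a1, a2, a3, a4, a6] ∧ (2 : ℤ) ^ 7 ∣ c6Of [a1, a2, a3, a4, a6]) ∨
      (q = 2 ∧ ¬ (2 : ℤ) ^ 24 ∣ discOf [a1, a2, a3, a4, a6] ∧
        ∃ M : ℤ, c6Of [a1, a2, a3, a4, a6] = 1024 * M ∧ ¬ (2 : ℤ) ∣ M) ∨
      (q = 3 ∧ (3 : ℤ) ^ 8 ∣ c6Of [a1, a2, a3, a4, a6] ∧ ¬ (3 : ℤ) ^ 9 ∣ c6Of [a1, a2, a3, a4, a6])) :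
    (⟨a1, a2, a3, a4, a6⟩ : WeierstrassCurve ℚ).IsGloballyMinimal where
  isIntegral := isIntegral_of_exists_lift (𝓞 ℚ) ⟨(a1 : 𝓞 ℚ), by simp⟩ ⟨(a2 : 𝓞 ℚ), by simp⟩
    ⟨(a3 : 𝓞 ℚ), by simp⟩ ⟨(a4 : 𝓞 ℚ), by simp⟩ ⟨(a6 : 𝓞 ℚ), by simp⟩
  isMinimal v := by
    set W : WeierstrassCurve ℚ := ⟨a1, a2, a3, a4, a6⟩ with hW
    have hle : ∀ m : ℤ, v.valuation ℚ (m : ℚ) ≤ 1 := fun m ↦ by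
      have hm : (m : ℚ) = algebraMap (𝓞 ℚ) ℚ (m : 𝓞 ℚ) := by simp
      rw [hm]
      exact v.valuation_le_one _
    have hint : W.IsIntegralAt v :=
      W.isIntegralAt_of_valuation_le_one v (hle a1) (hle a2) (hle a3) (hle a4) (hle a6)
    have hΔ : W.Δ = ((discOf [a1, a2, a3, a4, a6] : ℤ) : ℚ) := by
      simp only [hW, WeierstrassCurve.Δ, WeierstrassCurve.b₂, WeierstrassCurve.b₄, WeierstrassCurve.b₆,
        WeierstrassCurve.b₈, discOf, invariants]
      push_cast
      ring
    have hc4 : W.c₄ = ((c4Of [a1, a2, a3, a4, a6] : ℤ) : ℚ) := by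
      simp only [hW, WeierstrassCurve.c₄, WeierstrassCurve.b₂, WeierstrassCurve.b₄, c4Of, invariants]
      push_cast
      ring
    have hc6 : W.c₆ = ((c6Of [a1, a2, a3, a4, a6] : ℤ) : ℚ) := by
      simp only [hW, WeierstrassCurve.c₆, WeierstrassCurve.b₂, WeierstrassCurve.b₄, WeierstrassCurve.b₆,
        c6Of, invariants]
      push_cast
      ring
    haveI hYint : (W.baseChange (v.adicCompletion ℚ)).IsIntegral (v.adicCompletionIntegers ℚ) := hint
    have hYc4 : Valued.v (W.baseChange (v.adicCompletion ℚ)).c₄ = v.valuation ℚ W.c₄ := by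
      rw [WeierstrassCurve.baseChange, map_c₄, WeierstrassCurve.valued_algebraMap_adicCompletion]
    have hYc6 : Valued.v (W.baseChange (v.adicCompletion ℚ)).c₆ = v.valuation ℚ W.c₆ := by
      rw [WeierstrassCurve.baseChange, map_c₆, WeierstrassCurve.valued_algebraMap_adicCompletion]
    rcases h _ (prime_natGenerator v) with (h12 | h4) | ⟨h2, h8, h7⟩ | ⟨h2, h24, M, hM, hModd⟩ |
        ⟨h3, h8, h9⟩
    · exact isMinimalAt_of_lt_valuation_Δ_holds hint
        (by rw [hΔ]; exact exp_neg_lt_valuation_intCast_of_not_pow_dvd v h12)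
    · exact isMinimalAt_of_lt_valuation_c₄ hint
        (by rw [hc4]; exact exp_neg_lt_valuation_intCast_of_not_pow_dvd v h4)
    · -- pattern F2a at `2`
      refine isMinimal_two_of_valued_c₄_c₆ v h2 _ ?_ ?_
      · rw [hYc4, hc4]
        exact exp_neg_lt_valuation_intCast_of_not_pow_dvd v (by rw [h2]; exact_mod_cast h8)
      · rw [hYc6, hc6]
        exact_mod_cast Rat.valuation_intCast_le v (e := 7) (by rw [h2]; exact_mod_cast h7)
    · -- pattern F2c at `2`
      refine isMinimalAt_two_of_c₆_eq_1024_mul v W h2 hint ?_ (M := M) (by rw [hc6, hM]; push_cast; ring)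
        hModd
      rw [hΔ]
      exact_mod_cast exp_neg_lt_valuation_intCast_of_not_pow_dvd v (e := 24) (by rw [h2]; exact_mod_cast h24)
    · -- pattern F3 at `3`
      refine isMinimal_three_of_valued_c₆ v h3 _ ?_ ?_
      · rw [hYc6, hc6]
        exact_mod_cast Rat.valuation_intCast_le v (e := 8) (by rw [h3]; exact_mod_cast h8)
      · rw [hYc6, hc6]
        exact_mod_cast exp_neg_lt_valuation_intCast_of_not_pow_dvd v (e := 9)
          (by rw [h3]; exact_mod_cast h9)

/-- **Bounded form** (the shape `decide` evaluates): `Δ ≠ 0`, `|Δ| < 512¹²`, and for every `q < 512`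
the disjunction "`q < 2`, or `q¹² ∤ |Δ|`, or `q⁴ ∤ |c₄|`, or pattern F2a / F2c / F3"; primes `q ≥ 512`
have `q¹² > |Δ|`. [cite: SilvermanAEC2009, VII.1 Remark 1.1] [cite: Kraus1989, Prop. 1 and Prop. 2] -/
theorem isGloballyMinimal_of_krausCriterion_bounded₂ (a1 a2 a3 a4 a6 : ℤ)
    (h0 : discOf [a1, a2, a3, a4, a6] ≠ 0) (hB : (discOf [a1, a2, a3, a4, a6]).natAbs < 512 ^ 12)
    (h : ∀ q < 512, q < 2 ∨ ¬ q ^ 12 ∣ (discOf [a1, a2, a3, a4, a6]).natAbs ∨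
      ¬ q ^ 4 ∣ (c4Of [a1, a2, a3, a4, a6]).natAbs ∨
      (q = 2 ∧ ¬ (2 : ℤ) ^ 8 ∣ c4Of [a1, a2, a3, a4, a6] ∧ (2 : ℤ) ^ 7 ∣ c6Of [a1, a2, a3, a4, a6]) ∨
      (q = 2 ∧ ¬ (2 : ℤ) ^ 24 ∣ discOf [a1, a2, a3, a4, a6] ∧ (1024 : ℤ) ∣ c6Of [a1, a2, a3, a4, a6] ∧
        ¬ (2 : ℤ) ∣ c6Of [a1, a2, a3, a4, a6] / 1024) ∨
      (q = 3 ∧ (3 : ℤ) ^ 8 ∣ c6Of [a1, a2, a3, a4, a6] ∧ ¬ (3 : ℤ) ^ 9 ∣ c6Of [a1, a2, a3, a4, a6])) :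
    (⟨a1, a2, a3, a4, a6⟩ : WeierstrassCurve ℚ).IsGloballyMinimal := by
  refine isGloballyMinimal_of_krausCriterion₂ a1 a2 a3 a4 a6 fun q hq ↦ ?_
  have hpos : 0 < (discOf [a1, a2, a3, a4, a6]).natAbs := Int.natAbs_pos.mpr h0
  by_cases hqB : q < 512
  · rcases h q hqB with hlt | h12 | h4 | hF2a | ⟨h2, h24, h1024, hodd⟩ | hF3
    · exact absurd hq.two_le (by omega)
    · refine Or.inl (Or.inl fun h12' ↦ h12 ?_)
      rw [← Int.natCast_dvd]; exact_mod_cast h12'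
    · refine Or.inl (Or.inr fun h4' ↦ h4 ?_)
      rw [← Int.natCast_dvd]; exact_mod_cast h4'
    · exact Or.inr (Or.inl hF2a)
    · refine Or.inr (Or.inr (Or.inl ⟨h2, h24, c6Of [a1, a2, a3, a4, a6] / 1024, ?_, hodd⟩))
      exact (Int.mul_ediv_cancel' h1024).symm
    · exact Or.inr (Or.inr (Or.inr hF3))
  · refine Or.inl (Or.inl fun h12 ↦ ?_)
    have h12' : q ^ 12 ∣ (discOf [a1, a2, a3, a4, a6]).natAbs := by
      rw [← Int.natCast_dvd]; exact_mod_cast h12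
    have hle : q ^ 12 ≤ (discOf [a1, a2, a3, a4, a6]).natAbs := Nat.le_of_dvd hpos h12'
    have hge : 512 ^ 12 ≤ q ^ 12 := Nat.pow_le_pow_left (by omega) 12
    omega

/-! ### §3. Ellipticity of a literal model -/

/-- `Δ` of the rational curve `[a₁,…,a₆]` is the recheck integer `discOf`. [cite: SilvermanAEC2009, III.1] -/
theorem ratCurve_Δ (a1 a2 a3 a4 a6 : ℤ) :
    (⟨a1, a2, a3, a4, a6⟩ : WeierstrassCurve ℚ).Δ = ((discOf [a1, a2, a3, a4, a6] : ℤ) : ℚ) := by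
  simp only [WeierstrassCurve.Δ, WeierstrassCurve.b₂, WeierstrassCurve.b₄, WeierstrassCurve.b₆,
    WeierstrassCurve.b₈, discOf, invariants]
  push_cast
  ring

/-- A literal integer model with `discOf ≠ 0` is an elliptic curve over `ℚ`. [cite: SilvermanAEC2009, III.1] -/
theorem isElliptic_of_discOf_ne_zero (a1 a2 a3 a4 a6 : ℤ) (h : discOf [a1, a2, a3, a4, a6] ≠ 0) :
    (⟨a1, a2, a3, a4, a6⟩ : WeierstrassCurve ℚ).IsElliptic :=
  ⟨by rw [ratCurve_Δ, isUnit_iff_ne_zero]; exact_mod_cast h⟩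

end Summit.BirchSwinnertonDyer.Rank1Residual.X11b

end
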